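import Literature.NumberTheory.EllipticCurves.GreenbergVatsal2000.CharacterPAdicLFunctions
import Literature.NumberTheory.EllipticCurves.GreenbergVatsal2000.ResidualSelmerGroups
import Literature.NumberTheory.EllipticCurves.GreenbergVatsal2000.CongruentCurves
import Literature.NumberTheory.GaloisRepresentations.ModNCyclotomicCharacter
import HarnessLib

/-!
# Greenberg–Vatsal 2000, §3 pp. 41–42 with §2 pp. 28–29 (Ferrero–Washington, Mazur–Wiles,
# Props. (2.6)/(2.8)): `μ(L_{Σ₀}(C,T)) = μ(L_{Σ₀}(D,T)) = 0`, `λ(L_{Σ₀}(C,T)) = dim H¹(ℚ_Σ/ℚ_∞, Φ)`,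
# `λ(L_{Σ₀}(D,T)) = dim U` — the CHARACTER-THEORETIC inputs of display (16)/(28), in which no
# elliptic curve occurs

HONEST FRAMING (BSD rank-`≤ 1` residual cell `b2b-bsdres`, home
`run/shared/lean/b2b/bsd-rank1-residual/`, unit `b2b-bsdres-eisenstein-p2`, class X2): the cell
deletes the COMBINATION-SHAPED residual classes of the rank-`≤ 1` BSD formula from PUBLISHED
theorems only and TYPES the construction-shaped ones; this is not "finishing BSD". This file records
TWO published statements as named facts (`def … : Prop`, nothing asserted; D-0014/D-0026) —
statements of CYCLOTOMIC Iwasawa theory over `ℚ` about a one-dimensional `𝔽_p`-representation of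
`Γ_ℚ` (an even character `φ` ramified at `p`, resp. an odd character `ψ` unramified at `p`), in which no
elliptic curve and no reduction type occurs: the `μ`-invariant of Greenberg–Vatsal's `L_{Σ₀}(C, T)`
(resp. `L_{Σ₀}(D, T)`) vanishes (Ferrero–Washington) and its `λ`-invariant is the `𝔽_p`-dimension
of `H¹(ℚ_Σ/ℚ_∞, Φ)` (resp. of `U = S^{Σ₀}_Ψ(ℚ_∞) = H¹_unr`) (Mazur–Wiles with GV Props. (2.6)/(2.8),
Cor. (2.3)). Together with the Eisenstein congruence of Thm. (3.11) (`EisensteinCongruence.lean`,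
the only input in which the elliptic curve occurs) they are the printed content of the cell's
folded reading-facts `nonPrimitive_unitContent_and_lambda_eq_residual_of_lineRamifiedEven[_goodOrd]`,
which become kernel consequences (`Summits/…/X2/EisensteinCongruenceOfFacts.lean`).

## Citation header (held text `paper:arxiv-math_9906215`, dvips stream decoded by this seat,
## `…-g21-0/folder/work/lit/gv2000_decoded.txt`: p0064 = p. 41, p0065 = p. 42, p0051–p0053 = pp. 28–30)

* p. 41 (after (26)): "The Ferrero-Washington theorem asserts that `L(C, χ, T) ∉ pΛ` and the
  Mazur-Wiles theorem implies that the `λ`-invariant of `L(C, χ, T)` is equal to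
  `corank_O(S_{C⊗χ}(ℚ_∞))`, which we denoted by `λ_{χωψ⁻¹}` in section 1."
* p. 42: "The `λ`-invariant of `L_{Σ₀}(C, χ, T)` is `λ_{χωψ⁻¹,Σ₀} = λ_{χφ,Σ₀}`. … The `μ`-invariant of
  `L(D, χ, T)` is again zero and its `λ`-invariant is `λ_{ωχ⁻¹ψ⁻¹} = λ_{χψ}`, which is equal to
  `corank_O(S_{D⊗χ}(ℚ_∞))`. … The `λ`-invariant of `L_{Σ₀}(D, χ, T)` is `λ_{χψ,Σ₀}`."; p. 43: "The
  `μ`-invariant of `L(G, χ, T)` is zero because that is true for each factor in (28). Also, the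
  `λ`-invariant of `L(G, χ, T)` is equal to `λ_{χφ,Σ₀} + λ_{χψ,Σ₀}`. The two terms are the
  `O`-coranks of `S^{Σ₀}_{C⊗χ}(ℚ_∞)` and `S^{Σ₀}_{D⊗χ}(ℚ_∞)`, respectively."
* p. 29 (`θ` even): "We have `d⁺ = 1` and so we must take `W_p = V_p`. Therefore, `H_p(ℚ_∞, A) = 0`
  and it follows that `S_A(ℚ_∞) ≅ Hom_Δ(X_∞, A)` … The Ferrero-Washington theorem implies that the
  torsion `Λ`-module `(X_∞ ⊗_{ℤ_p} O)^ξ` has `μ`-invariant equal to zero. We denote its `O`-rank by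
  `λ_ξ`. Then, `λ_ξ = corank_O(S_A(ℚ_∞))`. … Let `Σ₀ = Σ − {p, ∞}`. Let
  `λ_{ξ,Σ₀} = corank_O(S^{Σ₀}_A(ℚ_∞))`. Assuming that `ξ` is nontrivial (so that `H⁰(ℚ, A[π]) = 0`),
  proposition (2.6) implies that `λ_{ξ,Σ₀} = dim_{O/πO}(S^{Σ₀}_{A[π]}(ℚ_∞))`."
* p. 29 (`θ` odd): "We have `d⁺ = 0` and so we must take `W_p = 0`. That is, the local condition at
  `η_p` occurring in the definition of `S_A(ℚ_∞)` is that a cocycle class be unramified. Thus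
  `S_A(ℚ_∞) = H¹_unr(ℚ_Σ/ℚ_∞, A)`, the group of everywhere unramified cocycle classes. … Again, the
  Ferrero-Washington theorem implies that the `Λ`-torsion module `(Y_∞ ⊗_{ℤ_p} O)^ξ` has
  `μ`-invariant zero. … Since `ξ` is odd, we have `H⁰(ℚ, A[π]) = 0` and therefore proposition (2.8)
  implies that `λ_{ξ,Σ₀} = dim_{O/πO}(S^{Σ₀}_{A[π]}(ℚ_∞))`. We can apply these observations to
  `θ = φ` and `θ = ψ`, regarding `Φ` or `Ψ` as `A[p]` where `A ≅ ℚ_p/ℤ_p` is a group and `G_ℚ` acts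
  by either `φ` or `ψ`. Now `φ` is even, but it is ramified and hence nontrivial. Also, `ψ` is odd
  but since `ψ = ωφ⁻¹`, we have `ψ ≠ ω`."
* p. 28: "`G_ℚ` acts on `Φ` by a character `φ : G_ℚ → (ℤ/pℤ)ˣ`, and on `Ψ` by a character `ψ`. …
  Then `φψ = ω` … `S^{Σ₀}_{E[p]}(ℚ_∞) = ker(H¹(ℚ_Σ/ℚ_∞, E[p]) → H¹(I_p, Ψ))` … `U = ker(H¹(ℚ_Σ/ℚ_∞,
  Ψ) → H¹(I_p, Ψ))`"; p. 2: "`p^{μ_E}` is the exact power of `p` dividing `f_E(T)`" (unit content).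

## The tree's vocabulary (no new definition)

`p` odd, `κ : ZpExtension ℚ p` cyclotomic (`ℚ_∞ = ℚ̄^{ker κ}`), `φ` a primitive even Dirichlet
character modulo `m` (`p ∣ m`) and `ψ` a primitive odd Dirichlet character modulo `d` (`p ∤ d`),
both with values in `𝔽_p` (GV p. 28), `χ_N = modNCyclotomicCharacter ℚ N` the mod-`N` cyclotomic
character of `Γ_ℚ` (a Dirichlet character `θ` mod `N` is read as the Galois character `θ ∘ χ_N`,
Washington Ch. 3 / tree `DirichletCharacterOfGaloisCharacter.lean`), `Φ` (resp. `Ψ`) ANY discrete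
`Γ_ℚ`-module of order `p` on which `σ` acts as the scalar `φ(χ_m(σ))` (resp. `ψ(χ_d(σ))`), `Σ₀ ∌ p`
a finite set of places containing the primes `≠ p` of `m` (resp. the primes of `d`), so that
`Σ = Σ₀ ∪ {p, ∞}` contains the ramification of the character; `H¹(ℚ_Σ/ℚ_∞, Φ)` =
`unramifiedOutside (ker κ) Φ p Σ₀` and `U ∩ H¹(ℚ_Σ/ℚ_∞, Ψ) = S^{Σ₀}_Ψ(ℚ_∞)` =
`unramifiedSelmer (ker κ) Ψ p Σ₀` (`GreenbergSelmerGroups.lean`, `ResidualSelmerGroups.lean`; for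
the curve's `Φ₀ ≤ E[p]` these are `residualLineH1` / `residualQuotSelmer` by definition);
`IsCharacterLFunctionC/D` (`CharacterPAdicLFunctions.lean`); `HasUnitContent g` (`μ(g) = 0`) and
`λ(g) = ord_T(g mod p)` for `g ∈ Λ` with unit content (so that "`λ = dim`" is "`p^{ord_T(g mod p)} =
#`" for a finite `𝔽_p`-space).
-/

noncomputable section

open scoped Classical

open NumberField IsDedekindDomain Field Literature.NumberTheory.EllipticCurves
  Literature.NumberTheory.GaloisRepresentations

namespace Literature.NumberTheory.EllipticCurves.GreenbergVatsal2000

/-- **Greenberg–Vatsal 2000, p. 41 / p. 42 with p. 29 (Prop. (2.6)): `μ(L_{Σ₀}(C, T)) = 0`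
(Ferrero–Washington) and `λ(L_{Σ₀}(C, T)) = λ_{φ,Σ₀} = dim_{𝔽_p} H¹(ℚ_Σ/ℚ_∞, Φ)` (Mazur–Wiles).**
p. 41: "The Ferrero-Washington theorem asserts that `L(C, χ, T) ∉ pΛ` and the Mazur-Wiles theorem
implies that the `λ`-invariant of `L(C, χ, T)` is equal to `corank_O(S_{C⊗χ}(ℚ_∞))`, which we
denoted by `λ_{χωψ⁻¹}`"; p. 42: "The `λ`-invariant of `L_{Σ₀}(C, χ, T)` is `λ_{χωψ⁻¹,Σ₀} =
λ_{χφ,Σ₀}`"; p. 29 (`θ = φ` even, nontrivial): "`W_p = V_p` … `H_p(ℚ_∞, A) = 0` …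
`λ_{ξ,Σ₀} = corank_O(S^{Σ₀}_A(ℚ_∞))` … proposition (2.6) implies that
`λ_{ξ,Σ₀} = dim_{O/πO}(S^{Σ₀}_{A[π]}(ℚ_∞))`", and `S^{Σ₀}_{A_φ[p]}(ℚ_∞) = H¹(ℚ_Σ/ℚ_∞, Φ)` (no local
condition at `p` or at `Σ₀`, p. 28). TRANSCRIPTION (`χ = 1`, `O = ℤ_p`): `p` odd, `κ` the
cyclotomic `ℤ_p`-extension, `φ` a primitive even Dirichlet character mod `m`, `p ∣ m` ("even and
ramified at `p`", so `φ ≠ 1`), with values in `𝔽_p`, read as the character `φ ∘ χ_m` of `Γ_ℚ`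
(`χ_m` the mod-`m` cyclotomic character), `Σ₀ ∌ p` a finite set of places containing every prime
`≠ p` of `m` (so `Σ = Σ₀ ∪ {p, ∞}` contains the ramification of `φ`), `Φ` a discrete `Γ_ℚ`-module
of order `p` on which every `σ` acts as the scalar `φ(χ_m(σ))`: for every `g ∈ Λ` with
`IsCharacterLFunctionC p φ Σ₀ g` (i.e. `g = L_{Σ₀}(C, T)`, `C[p] = Φ`),
`g` has unit content and `p^{ord_T(g mod p)} = #H¹(ℚ_Σ/ℚ_∞, Φ)`
(`unramifiedOutside (ker κ) Φ p Σ₀`). A statement about the character `φ` only; no elliptic curve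
occurs. Named fact; nothing asserted.
-- TODO(general form): GV allow an even twist `χ` (`C ⊗ χ`, `O = ℤ_p[χ]`) and state
-- `λ = corank_O S^{Σ₀}_{A_φ}(ℚ_∞)` for the divisible module `A_φ`; only `χ = 1` and the residual
-- form of Prop. (2.6) are filed.
[cite: GreenbergVatsal2000, §3 pp. 41–42 (Ferrero–Washington, Mazur–Wiles: μ and λ of L_{Σ₀}(C,χ,T)) with §2 pp. 28–29 (Prop. (2.6), S_A(ℚ_∞) for θ even)] -/
def characterLFunctionC_hasUnitContent_and_order_eq_card : Prop :=
  ∀ (p : ℕ) [Fact p.Prime] (κ : ZpExtension ℚ p) (m : ℕ) [NeZero m]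
    (φ : DirichletCharacter (ZMod p) m) (S₀ : Finset (HeightOneSpectrum (𝓞 ℚ)))
    (Φ : Type) [AddCommGroup Φ] [DistribMulAction (absoluteGaloisGroup ℚ) Φ]
    [TopologicalSpace Φ] [DiscreteTopology Φ],
    p ≠ 2 → p ∣ m → φ.IsPrimitive → φ.Even → κ.IsCyclotomic →
    (∀ v ∈ S₀, ((p : ℕ) : 𝓞 ℚ) ∉ v.asIdeal) →
    (∀ ℓ : ℕ, ℓ.Prime → ℓ ∣ m → ℓ ≠ p → ∃ v ∈ S₀, ((ℓ : ℕ) : 𝓞 ℚ) ∈ v.asIdeal) →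
    Nat.card Φ = p →
    (∀ (σ : absoluteGaloisGroup ℚ) (x : Φ),
      σ • x = (φ ((modNCyclotomicCharacter ℚ m σ : (ZMod m)ˣ) : ZMod m)).val • x) →
    ∀ g : IwasawaAlgebra p, IsCharacterLFunctionC p φ S₀ g →
      HasUnitContent g ∧
        p ^ (PowerSeries.map (PadicInt.toZMod (p := p)) g).order.toNat =
          Nat.card (unramifiedOutside κ.kerSubgroup Φ p (↑S₀ : Set (HeightOneSpectrum (𝓞 ℚ))))

/-- **Greenberg–Vatsal 2000, p. 42 with p. 29 (Prop. (2.8)): `μ(L_{Σ₀}(D, T)) = 0`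
(Ferrero–Washington) and `λ(L_{Σ₀}(D, T)) = λ_{ψ,Σ₀} = dim_{𝔽_p} U`, `U = S^{Σ₀}_Ψ(ℚ_∞) = H¹_unr`
(Mazur–Wiles).** p. 42: "The `μ`-invariant of `L(D, χ, T)` is again zero and its `λ`-invariant is
`λ_{ωχ⁻¹ψ⁻¹} = λ_{χψ}`, which is equal to `corank_O(S_{D⊗χ}(ℚ_∞))`. … The `λ`-invariant of
`L_{Σ₀}(D, χ, T)` is `λ_{χψ,Σ₀}`"; p. 29 (`θ = ψ` odd, `≠ ω`): "`W_p = 0`. That is, the local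
condition at `η_p` … is that a cocycle class be unramified. Thus `S_A(ℚ_∞) = H¹_unr(ℚ_Σ/ℚ_∞, A)` …
proposition (2.8) implies that `λ_{ξ,Σ₀} = dim_{O/πO}(S^{Σ₀}_{A[π]}(ℚ_∞))`"; p. 28:
"`U = ker(H¹(ℚ_Σ/ℚ_∞, Ψ) → H¹(I_p, Ψ))`". TRANSCRIPTION (`χ = 1`, `O = ℤ_p`): `p` odd, `κ`
cyclotomic, `ψ` a primitive odd Dirichlet character mod `d`, `p ∤ d`, with values in `𝔽_p`,
`Σ₀ ∌ p` a finite set of places containing every prime of `d`, `Ψ` a discrete `Γ_ℚ`-module of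
order `p` on which every `σ` acts as the scalar `ψ(χ_d(σ))`: for every `g ∈ Λ` with
`IsCharacterLFunctionD p ψ Σ₀ g` (i.e. `g = L_{Σ₀}(D, T)`), `g` has unit content and
`p^{ord_T(g mod p)} = #S^{Σ₀}_Ψ(ℚ_∞)` (`unramifiedSelmer (ker κ) Ψ p Σ₀`: classes unramified outside
`Σ₀` and at `p`). A statement about the character `ψ` only; no elliptic curve occurs. Named fact;
nothing asserted.
-- TODO(general form): as above (`D ⊗ χ`, `O = ℤ_p[χ]`, corank form for the divisible `A_ψ`).
[cite: GreenbergVatsal2000, §3 p. 42 (Ferrero–Washington, Mazur–Wiles: μ and λ of L_{Σ₀}(D,χ,T)) with §2 pp. 28–29 (Prop. (2.8), S_A(ℚ_∞) = H¹_unr for θ odd)] -/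
def characterLFunctionD_hasUnitContent_and_order_eq_card : Prop :=
  ∀ (p : ℕ) [Fact p.Prime] (κ : ZpExtension ℚ p) (d : ℕ) [NeZero d]
    (ψ : DirichletCharacter (ZMod p) d) (S₀ : Finset (HeightOneSpectrum (𝓞 ℚ)))
    (Ψ : Type) [AddCommGroup Ψ] [DistribMulAction (absoluteGaloisGroup ℚ) Ψ]
    [TopologicalSpace Ψ] [DiscreteTopology Ψ],
    p ≠ 2 → ¬ p ∣ d → ψ.IsPrimitive → ψ.Odd → κ.IsCyclotomic →
    (∀ v ∈ S₀, ((p : ℕ) : 𝓞 ℚ) ∉ v.asIdeal) →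
    (∀ ℓ : ℕ, ℓ.Prime → ℓ ∣ d → ∃ v ∈ S₀, ((ℓ : ℕ) : 𝓞 ℚ) ∈ v.asIdeal) →
    Nat.card Ψ = p →
    (∀ (σ : absoluteGaloisGroup ℚ) (y : Ψ),
      σ • y = (ψ ((modNCyclotomicCharacter ℚ d σ : (ZMod d)ˣ) : ZMod d)).val • y) →
    ∀ g : IwasawaAlgebra p, IsCharacterLFunctionD p ψ S₀ g →
      HasUnitContent g ∧
        p ^ (PowerSeries.map (PadicInt.toZMod (p := p)) g).order.toNat =
          Nat.card (unramifiedSelmer κ.kerSubgroup Ψ p (↑S₀ : Set (HeightOneSpectrum (𝓞 ℚ))))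

end Literature.NumberTheory.EllipticCurves.GreenbergVatsal2000

end
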